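import Literature.AlgebraicTopology.SingularHomology.RelativeHurewiczIsZeroProofs
import Literature.AlgebraicTopology.SingularHomology.ExcisionMayerVietoris
import Literature.AlgebraicTopology.Homotopy.WeakEquivalenceLifts
import Literature.AlgebraicTopology.Homotopy.MappingCylinder
import Literature.AlgebraicTopology.Homotopy.HomotopyEquivWeakEquivProofs
import HarnessLib

/-!
# A weak homotopy equivalence induces isomorphisms on singular homology

Topic `Literature/AlgebraicTopology/SingularHomology`. E. H. Spanier, *Algebraic Topology* (1981),
Ch. 7, Sec. 6, Thm. 25 ("A weak homotopy equivalence induces isomorphisms of the corresponding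
singular homology groups"; A. Hatcher, *Algebraic Topology* (2002), Prop. 4.21), for arbitrary
spaces (no connectivity hypotheses) and coefficients in any commutative ring `R`. This is the step
"therefore `f'` induces an isomorphism of the homology of `E'` with the homology of `E`" of the
construction of the spectral sequence of a fibration over a general base (Spanier Ch. 9, Sec. 2,
Thm. 17), a brick of the printed proof of
`Literature.AlgebraicTopology.Homotopy.Spanier1981_eulerChar_fibreBundle`. All PROVED:

* `StagedDeformation.*` — the Eilenberg–Spanier deformation of the singular chains of `X` into a
  subspace `A` (Spanier Ch. 7, Sec. 4, Lemma 7 and Thm. 8) run from an ARBITRARY coherent family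
  of stages `StageData A k`, `k ≤ m` (`RelativeEilenbergDeformation.lean`): the chain homotopy
  `∂D + D∂ = τ - 𝟙` and the vanishing `Hᵢ(X, A; R) = 0`, `i ≤ m`. This generalises the pipeline
  `RelativeDeformation.*` of `RelativeHurewiczIsZeroProofs.lean`, which is tied to the family
  `RelativeDeformation.stage` and hence to a PATH-CONNECTED `X` (its stage `0` joins every point
  to a chosen `a₀ ∈ A`); weak equivalences between disconnected spaces (total spaces of bundles
  with disconnected fibre) need the general form. The proofs are those of that file, verbatim up
  to the stage family.
* `StagedDeformation.stageZeroOfJoined`, `stageOfJoined` — stage `0` from the hypothesis that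
  every point of `X` is joined by a path to a point of `A` (surjectivity of `π₀(A) → π₀(X)`), and
  the tower built on it by `RelativeDeformation.exists_next` from `π_{k+1}(X, A, a) = 0`.
* `subsingleton_relHomotopyGroup_of_isWeakHomotopyEquiv` — if the inclusion `A ↪ X` is a weak
  homotopy equivalence then `πₖ(X, A, a) = 0` for all `k ≥ 1`, `a ∈ A` (exactness of the homotopy
  sequence of the pair, `RelativeHomotopySequence.lean`).
* **`isZero_relativeSingularHomology_of_isWeakHomotopyEquiv`** — `Hᵢ(X, A; R) = 0` for all `i`
  when `A ↪ X` is a weak homotopy equivalence; **`isIso_singularHomology_map_subsetIncl_of_isWeakHomotopyEquiv`**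
  — then `Hᵢ(A; R) → Hᵢ(X; R)` is an isomorphism for all `i`.
* **`isIso_singularHomology_map_of_isWeakHomotopyEquiv`** (Spanier 7.6.25 / Hatcher 4.21) — for
  every weak homotopy equivalence `f : X → Y` (same universe) and every `n`,
  `f_* : Hₙ(X; R) → Hₙ(Y; R)` is an isomorphism: `f = retr ∘ inX` through the mapping cylinder
  (`MappingCylinder.lean`), `inX` is a weak equivalence by two-out-of-three, the copy of `X` in
  `M_f` is a subspace to which the previous result applies, and `retr` is a homotopy equivalence.

## References

* E. H. Spanier, *Algebraic Topology*, Springer (1981), Ch. 7, Sec. 4, Lemma 7, Thm. 8; Sec. 6,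
  Thm. 25 (held copy `book:spanier1981-algebraic-topology`). [Spanier1981]
* A. Hatcher, *Algebraic Topology*, CUP (2002), Prop. 4.21, Thm. 4.3. [HatcherAT2002]
-/

noncomputable section

-- as in `RelativeHurewiczIsZeroProofs`: the chain modules of the concrete complex are `Finsupp`s
-- up to unfolding of semireducible definitions (`ChainComplex.of`)
set_option backward.isDefEq.respectTransparency false

open Set CategoryTheory Limits
open scoped unitInterval
open Literature.AlgebraicTopology.Homotopy
open Literature.AlgebraicTopology.Homotopy.WhiteheadCW (tau tau_pos tau_lt_one tau_le_one tau_lt_succ)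

universe u v

namespace Literature.AlgebraicTopology.SingularHomology

namespace StagedDeformation

open SingularSimplex RelativeDeformation

variable {X : Type u} [TopologicalSpace X] {A : Set X} {m : ℕ}
  (stg : (k : ℕ) → k ≤ m → StageData A k)
  (hstg : ∀ (k : ℕ) (hk : k + 1 ≤ m) (η : SingularSimplex X (k + 1)) (i : Fin (k + 2))
    (t : StdSimplex k) (s : I),
    (stg (k + 1) hk).P η (stdFace i t, s) = (stg k (Nat.le_of_succ_le hk)).P (η.face i) (t, s))

/-! ### The deformation as maps of the cylinders (arbitrary stage family) -/

/-- The homotopy `P ρ` of a singular `k`-simplex (`k ≤ m`) as a map of the cylinder `Δ^k × I`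
(as `RelativeDeformation.cylOf`, for an arbitrary stage family). [folklore] -/
def cylOf {k : ℕ} (hk : k ≤ m) (ρ : SingularSimplex X k) : C(Cyl.{u} k, X) :=
  ((stg k hk).P ρ).comp ⟨ULift.down, continuous_uliftDown⟩

/-- Pointwise formula for `cylOf`. [folklore] -/
@[simp]
lemma cylOf_apply {k : ℕ} (hk : k ≤ m) (ρ : SingularSimplex X k) (p : Cyl.{u} k) :
    cylOf stg hk ρ p = (stg k hk).P ρ p.down := rfl

/-- The end `z ↦ P ρ (z, 1)` of the homotopy of `ρ` (as `RelativeDeformation.endMap`). [folklore] -/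
def endMap {k : ℕ} (hk : k ≤ m) (ρ : SingularSimplex X k) : C(StdSimplex k, X) :=
  ((stg k hk).P ρ).comp ⟨fun z => (z, 1), continuous_id.prodMk continuous_const⟩

/-- Pointwise formula for `endMap`. [folklore] -/
@[simp]
lemma endMap_apply {k : ℕ} (hk : k ≤ m) (ρ : SingularSimplex X k) (z : StdSimplex k) :
    endMap stg hk ρ z = (stg k hk).P ρ (z, 1) := rfl

/-- The deformed simplex `ρ̄ = P(ρ)(·, 1)` (Spanier 1966, Lemma 7.4.7 (b)), a singular simplex of
`A` (as `RelativeDeformation.endSimplex`). [cite: Spanier1981, Ch. 7 §4 Lemma 7] -/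
def endSimplex {k : ℕ} (hk : k ≤ m) (ρ : SingularSimplex X k) : SingularSimplex X k :=
  ofMap (endMap stg hk ρ)

/-- The deformed simplex lies in `A`. [folklore] -/
lemma range_endSimplex_subset {k : ℕ} (hk : k ≤ m) (ρ : SingularSimplex X k) :
    (endSimplex stg hk ρ).range ⊆ A := by
  rintro _ ⟨z, rfl⟩
  rw [endSimplex, toContinuousMap_ofMap, endMap_apply]
  exact (stg k hk).endA ρ z

/-- (a) The homotopy starts at the simplex: `ι₀♯ = ρ`. [folklore] -/
lemma botSimplex_map_cylOf {k : ℕ} (hk : k ≤ m) (ρ : SingularSimplex X k) :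
    (botSimplex k).map (cylOf stg hk ρ) = ρ := by
  rw [botSimplex, ofMap_map]
  conv_rhs => rw [← ofMap_toContinuousMap ρ]
  congr 1
  ext z
  exact (stg k hk).bot ρ z

/-- (b) The homotopy ends at the deformed simplex: `ι₁♯ = ρ̄`. [folklore] -/
lemma topSimplex_map_cylOf {k : ℕ} (hk : k ≤ m) (ρ : SingularSimplex X k) :
    (topSimplex k).map (cylOf stg hk ρ) = endSimplex stg hk ρ := by
  rw [topSimplex, ofMap_map, endSimplex]
  congr 1

include hstg in
/-- (c) Face compatibility on the cylinders: `P η ∘ (δⱼ × 1) = P (η.face j)`. [folklore] -/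
lemma cylOf_comp_cylFace {k : ℕ} (hk : k + 1 ≤ m) (η : SingularSimplex X (k + 1)) (j : Fin (k + 2)) :
    (cylOf stg hk η).comp (cylFace k j) = cylOf stg (Nat.le_of_succ_le hk) (η.face j) := by
  ext p
  rcases p with ⟨z, t⟩
  exact hstg k hk η j z t

/-! ### The prism operator and the deformation operator on chains -/

variable (R : Type v) [CommRing R]

/-- The prism operator `D : C_k(X; R) → C_{k+1}(X; R)`, `ρ ↦ (P ρ)♯ (prismChain R k)` (Spanier
1966, proof of Lemma 7.4.7; as `RelativeDeformation.prismOp`). [cite: Spanier1981, Ch. 7 §4 Lemma 7] -/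
def prismOp {k : ℕ} (hk : k ≤ m) : CChain R X k →ₗ[R] CChain R X (k + 1) :=
  Finsupp.lsum R fun ρ => LinearMap.toSpanSingleton R _
    (chainPush R (cylOf stg hk ρ) (k + 1) (prismChain R k))

variable {R} in
/-- The prism operator on an elementary chain. [folklore] -/
@[simp]
lemma prismOp_single {k : ℕ} (hk : k ≤ m) (ρ : SingularSimplex X k) (r : R) :
    prismOp stg R hk (Finsupp.single ρ r) =
      r • chainPush R (cylOf stg hk ρ) (k + 1) (prismChain R k) := by
  simp [prismOp]

/-- The deformation operator `τ : C_k(X; R) → C_k(X; R)`, `ρ ↦ ρ̄` (Spanier 1966, Lemma 7.4.7;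
as `RelativeDeformation.endOp`). [cite: Spanier1981, Ch. 7 §4 Lemma 7] -/
def endOp {k : ℕ} (hk : k ≤ m) : CChain R X k →ₗ[R] CChain R X k :=
  Finsupp.lmapDomain R R (endSimplex stg hk)

variable {R}

/-- The deformation operator on an elementary chain. [folklore] -/
@[simp]
lemma endOp_single {k : ℕ} (hk : k ≤ m) (ρ : SingularSimplex X k) (r : R) :
    endOp stg R hk (Finsupp.single ρ r) = Finsupp.single (endSimplex stg hk ρ) r :=
  Finsupp.mapDomain_single

include hstg in
/-- The prism boundary formula on an elementary chain: `∂ D η = η̄ - η - D ∂η` for a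
`(k+1)`-simplex `η`, `k + 1 ≤ m` (Spanier 1966, Lemma 7.4.7). [cite: Spanier1981, Ch. 7 §4 Lemma 7] -/
lemma bd_prismOp_single_succ {k : ℕ} (hk : k + 1 ≤ m) (η : SingularSimplex X (k + 1)) (r : R) :
    csingularChainComplex.bd R (k + 1) (prismOp stg R hk (Finsupp.single η r)) =
      Finsupp.single (endSimplex stg hk η) r - Finsupp.single η r -
        prismOp stg R (Nat.le_of_succ_le hk) (csingularChainComplex.bd R k (Finsupp.single η r)) := by
  rw [prismOp_single, map_smul, bd_chainPush, bd_prismChain_succ', map_sub, map_sub, chainPush_single,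
    chainPush_single, topSimplex_map_cylOf, botSimplex_map_cylOf, map_sum,
    csingularChainComplex.bd_single, map_sum]
  simp only [map_smul, prismOp_single, ← chainPush_comp, cylOf_comp_cylFace stg hstg, smul_sub,
    Finset.smul_sum, Finsupp.smul_single, smul_eq_mul, mul_one]
  congr 1
  refine Finset.sum_congr rfl fun j _ => ?_
  rw [smul_smul, mul_comm]

include hstg in
/-- `∂ D + D ∂ = τ - 𝟙` in positive degrees: `∂ D c = τ c - c - D ∂c` on `C_{k+1}(X; R)`,
`k + 1 ≤ m`. [cite: Spanier1981, Ch. 7 §4 Lemma 7] -/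
theorem bd_prismOp_succ {k : ℕ} (hk : k + 1 ≤ m) (c : CChain R X (k + 1)) :
    csingularChainComplex.bd R (k + 1) (prismOp stg R hk c) =
      endOp stg R hk c - c -
        prismOp stg R (Nat.le_of_succ_le hk) (csingularChainComplex.bd R k c) := by
  have h : (csingularChainComplex.bd R (k + 1)) ∘ₗ (prismOp stg R hk) =
      endOp stg R hk - LinearMap.id -
        (prismOp stg R (Nat.le_of_succ_le hk)) ∘ₗ (csingularChainComplex.bd R k) := by
    refine Finsupp.lhom_ext fun η r => ?_
    simp only [LinearMap.comp_apply, LinearMap.sub_apply, LinearMap.id_apply, endOp_single]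
    exact bd_prismOp_single_succ stg hstg hk η r
  exact LinearMap.congr_fun h c

/-- `∂ D = τ - 𝟙` in degree `0`: `∂ D c = τ c - c` on `C₀(X; R)`. [folklore] -/
theorem bd_prismOp_zero (c : CChain R X 0) :
    csingularChainComplex.bd R 0 (prismOp stg R (Nat.zero_le m) c) =
      endOp stg R (Nat.zero_le m) c - c := by
  have h : (csingularChainComplex.bd R 0) ∘ₗ (prismOp stg R (Nat.zero_le m)) =
      endOp stg R (Nat.zero_le m) - LinearMap.id := by
    refine Finsupp.lhom_ext fun ρ r => ?_
    simp only [LinearMap.comp_apply, LinearMap.sub_apply, LinearMap.id_apply, endOp_single]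
    rw [prismOp_single, map_smul, bd_chainPush, bd_prismChain_zero, map_sub, chainPush_single,
      chainPush_single, topSimplex_map_cylOf, botSimplex_map_cylOf, smul_sub, Finsupp.smul_single,
      Finsupp.smul_single, smul_eq_mul, mul_one]
  exact LinearMap.congr_fun h c

/-! ### Both operators respect the chains of `A` -/

/-- `τ c` is a chain of `A`, for every chain `c`. [folklore] -/
lemma endOp_mem_chainsIn {k : ℕ} (hk : k ≤ m) (c : CChain R X k) :
    endOp stg R hk c ∈ chainsIn R R X A k := by
  induction c using Finsupp.induction_linear with
  | zero => rw [map_zero]; exact Submodule.zero_mem _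
  | add f g hf hg => rw [map_add]; exact Submodule.add_mem _ hf hg
  | single ρ r =>
    rw [endOp_single]
    exact single_mem_chainsIn R R (range_endSimplex_subset stg hk ρ) r

/-- `D` maps chains of `A` to chains of `A`. [folklore] -/
lemma prismOp_mem_chainsIn {k : ℕ} (hk : k ≤ m) {c : CChain R X k} (hc : c ∈ chainsIn R R X A k) :
    prismOp stg R hk c ∈ chainsIn R R X A (k + 1) := by
  rw [mem_chainsIn_iff] at hc
  rw [← Finsupp.sum_single c, Finsupp.sum, map_sum]
  refine Submodule.sum_mem _ fun ρ hρ => ?_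
  rw [prismOp_single]
  refine Submodule.smul_mem _ _ (chainPush_mem_chainsIn _ (fun p => ?_) _)
  rw [cylOf_apply]
  exact (stg k hk).inA ρ (hc ρ hρ) p.down.1 p.down.2

/-! ### Relative cycles are relative boundaries; vanishing of relative homology -/

include hstg in
/-- Every relative `(k+1)`-cycle is a relative boundary, `k + 1 ≤ m` (Spanier 1966, Lemma 7.4.7
for the deformation of Thm. 7.4.8). [cite: Spanier1981, Ch. 7 §4 Thm. 8] -/
private theorem exists_bd_sub_mem_succ {k : ℕ} (hk : k + 1 ≤ m) (x : CChain R X (k + 1))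
    (hx : csingularChainComplex.bd R k x ∈ chainsIn R R X A k) :
    ∃ w : CChain R X (k + 2), csingularChainComplex.bd R (k + 1) w - x ∈ chainsIn R R X A (k + 1) := by
  refine ⟨-prismOp stg R hk x, ?_⟩
  have h : csingularChainComplex.bd R (k + 1) (-prismOp stg R hk x) - x =
      -endOp stg R hk x + prismOp stg R (Nat.le_of_succ_le hk) (csingularChainComplex.bd R k x) := by
    rw [map_neg, bd_prismOp_succ stg hstg]
    abel
  rw [h]
  exact Submodule.add_mem _ (Submodule.neg_mem _ (endOp_mem_chainsIn stg hk x))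
    (prismOp_mem_chainsIn stg _ hx)

include stg in
/-- Every `0`-chain is a relative boundary. [folklore] -/
private theorem exists_bd_sub_mem_zero (x : CChain R X 0) :
    ∃ w : CChain R X 1, csingularChainComplex.bd R 0 w - x ∈ chainsIn R R X A 0 := by
  refine ⟨-prismOp stg R (Nat.zero_le m) x, ?_⟩
  have h : csingularChainComplex.bd R 0 (-prismOp stg R (Nat.zero_le m) x) - x =
      -endOp stg R (Nat.zero_le m) x := by
    rw [map_neg, bd_prismOp_zero]
    abel
  rw [h]
  exact Submodule.neg_mem _ (endOp_mem_chainsIn stg (Nat.zero_le m) x)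

include stg hstg in
/-- **`Hᵢ(C(X)/C(A)) = 0` for `i ≤ m`** (concrete model), from any coherent family of stages up to
`m` (as `RelativeDeformation.isZero_homology_quotient`). [cite: Spanier1981, Ch. 7 §4 Thm. 8] -/
private theorem isZero_homology_quotient (i : ℕ) (hi : i ≤ m) :
    IsZero ((chainsInSub R R X A).quotient.homology i) := by
  have h : ∀ a : (chainsInSub R R X A).quotient.homology i, a = 0 := fun a => by
    obtain ⟨x, hx, rfl⟩ := (chainsInSub R R X A).relCls_surjective a
    rw [Subcomplex.relCls_eq_zero_iff,
      exists_d_sub_mem_iff_of_eq _ _ (ChainComplex.prev ℕ i)]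
    cases i with
    | zero =>
      obtain ⟨w, hw⟩ := exists_bd_sub_mem_zero stg (R := R) x
      exact ⟨w, by rw [csingularChainComplex.d_apply]; exact hw⟩
    | succ k =>
      rw [d_mem_iff_of_eq _ _ (ChainComplex.next_nat_succ k), csingularChainComplex.d_apply] at hx
      obtain ⟨w, hw⟩ := exists_bd_sub_mem_succ stg hstg (R := R) hi x hx
      exact ⟨w, by rw [csingularChainComplex.d_apply]; exact hw⟩
  haveI : Subsingleton ((chainsInSub R R X A).quotient.homology i) :=
    ⟨fun a b => (h a).trans (h b).symm⟩
  exact ModuleCat.isZero_of_subsingleton _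

include stg hstg in
/-- **`Hᵢ(X, A; R) = 0` for `i ≤ m`** from any coherent family of stages up to `m` (the vanishing
clause of Spanier's relative Hurewicz theorem, Ch. 7 §5 Thm. 4, in the generality of an arbitrary
stage `0`), for the tree's `relativeSingularHomology`. [cite: Spanier1981, Ch. 7 §5 Thm. 4] -/
private theorem isZero_relativeSingularHomology (i : ℕ) (hi : i ≤ m) :
    IsZero (relativeSingularHomology R R X A i) :=
  (isZero_homology_quotient stg hstg (R := R) i hi).of_iso
    (relativeSingularHomology.concreteIso R R X A i)

/-! ### Stage `0` from paths into `A`, and the tower -/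

section Zero

variable (hj : ∀ x : X, ∃ a : X, a ∈ A ∧ Joined x a)

open Classical in
/-- A path from `x` into `A`, run at double speed and then stationary: constant if `x ∈ A`,
otherwise a chosen path to a point of `A` (hypothesis `hj`), as `RelativeDeformation.pathInto`
with path-connectedness of `X` replaced by `hj`. [folklore] -/
def pathIntoOfJoined (x : X) : C(I, X) :=
  if x ∈ A then ContinuousMap.const I x
  else (Classical.choose_spec (hj x)).2.somePath.toContinuousMap.comp
    ⟨RelativeCompression.affTime 0 (1 / 2), RelativeCompression.continuous_affTime 0 (1 / 2)⟩

/-- The path starts at `x`. [folklore] -/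
lemma pathIntoOfJoined_zero (x : X) : pathIntoOfJoined hj x 0 = x := by
  unfold pathIntoOfJoined
  split_ifs with hx
  · rfl
  · show (Classical.choose_spec (hj x)).2.somePath (RelativeCompression.affTime 0 (1 / 2) 0) = x
    rw [RelativeCompression.affTime_self 0 (1 / 2) 0 rfl]
    exact (Classical.choose_spec (hj x)).2.somePath.source

/-- The path is stationary from time `1/2` on. [folklore] -/
lemma pathIntoOfJoined_of_half_le (x : X) (s : I) (hs : 1 / 2 ≤ (s : ℝ)) :
    pathIntoOfJoined hj x s = pathIntoOfJoined hj x 1 := by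
  unfold pathIntoOfJoined
  split_ifs with hx
  · rfl
  · show (Classical.choose_spec (hj x)).2.somePath (RelativeCompression.affTime 0 (1 / 2) s) =
      (Classical.choose_spec (hj x)).2.somePath (RelativeCompression.affTime 0 (1 / 2) 1)
    rw [RelativeCompression.affTime_eq_one 0 (1 / 2) one_half_pos s (by linarith),
      RelativeCompression.affTime_eq_one 0 (1 / 2) one_half_pos 1
        (by simp only [Set.Icc.coe_one]; norm_num)]

/-- The path ends in `A`. [folklore] -/
lemma pathIntoOfJoined_one_mem (x : X) : pathIntoOfJoined hj x 1 ∈ A := by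
  unfold pathIntoOfJoined
  split_ifs with hx
  · exact hx
  · show (Classical.choose_spec (hj x)).2.somePath (RelativeCompression.affTime 0 (1 / 2) 1) ∈ A
    rw [RelativeCompression.affTime_eq_one 0 (1 / 2) one_half_pos 1
      (by simp only [Set.Icc.coe_one]; norm_num)]
    rw [(Classical.choose_spec (hj x)).2.somePath.target]
    exact (Classical.choose_spec (hj x)).1

/-- A point of `A` is not moved. [folklore] -/
lemma pathIntoOfJoined_of_mem {x : X} (hx : x ∈ A) (s : I) : pathIntoOfJoined hj x s = x := by
  unfold pathIntoOfJoined
  rw [if_pos hx]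
  rfl

/-- The homotopy of the `0`-simplex `ρ`: its point moved along `pathIntoOfJoined`. [folklore] -/
def zeroHomotopyOfJoined (ρ : SingularSimplex X 0) : C(StdSimplex 0 × I, X) :=
  ⟨fun p => pathIntoOfJoined hj (toContinuousMap ρ default) p.2,
    (pathIntoOfJoined hj _).continuous.comp continuous_snd⟩

/-- **Stage `0` from paths into `A`** (Spanier 1966, proof of Thm. 7.4.8, case `q = 0`, with the
paths supplied by `hj`). [cite: Spanier1981, Ch. 7 §4 Thm. 8] -/
def stageZeroOfJoined : StageData A 0 where
  P := zeroHomotopyOfJoined hj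
  bot ρ z := by
    show pathIntoOfJoined hj (toContinuousMap ρ default) 0 = toContinuousMap ρ z
    rw [pathIntoOfJoined_zero, Subsingleton.elim z default]
  stat ρ z s hs := by
    show pathIntoOfJoined hj _ s = pathIntoOfJoined hj _ 1
    exact pathIntoOfJoined_of_half_le hj _ s (by rw [tau_zero] at hs; exact hs)
  endA ρ z := pathIntoOfJoined_one_mem hj _
  inA ρ hρ z s := by
    show pathIntoOfJoined hj (toContinuousMap ρ default) s ∈ A
    have hx : toContinuousMap ρ default ∈ A := hρ ⟨default, rfl⟩
    rw [pathIntoOfJoined_of_mem hj hx]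
    exact hx
  compat η := EilenbergRetraction.compatible_faces_zero (zeroHomotopyOfJoined hj) η

/-- **The tower of stages** from `hj` and `π_{k+1}(X, A, a) = 0`, `k + 1 ≤ m` (as
`RelativeDeformation.stage`). [cite: Spanier1981, Ch. 7 §4 Thm. 8] -/
def stageOfJoined (hπ : ∀ k : ℕ, k + 1 ≤ m → ∀ a : A, Subsingleton (RelHomotopyGroup.Pi (k + 1) X A a)) :
    (k : ℕ) → k ≤ m → StageData A k
  | 0, _ => stageZeroOfJoined hj
  | k + 1, hk => Classical.choose (exists_next (stageOfJoined hπ k (Nat.le_of_succ_le hk)) (hπ k hk))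

/-- Spanier's condition (c) for the tower `stageOfJoined`. [cite: Spanier1981, Ch. 7 §4 Lemma 7] -/
theorem stageOfJoined_succ_face
    (hπ : ∀ k : ℕ, k + 1 ≤ m → ∀ a : A, Subsingleton (RelHomotopyGroup.Pi (k + 1) X A a))
    (k : ℕ) (hk : k + 1 ≤ m) (η : SingularSimplex X (k + 1)) (i : Fin (k + 2)) (t : StdSimplex k)
    (s : I) :
    (stageOfJoined hj hπ (k + 1) hk).P η (stdFace i t, s) =
      (stageOfJoined hj hπ k (Nat.le_of_succ_le hk)).P (η.face i) (t, s) := by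
  rw [stageOfJoined]
  exact Classical.choose_spec (exists_next (stageOfJoined hj hπ k (Nat.le_of_succ_le hk)) (hπ k hk)) η i t s

end Zero

end StagedDeformation

/-! ### Weakly contractible pairs: the inclusion `A ↪ X` a weak homotopy equivalence -/

section Pair

variable {X : Type u} [TopologicalSpace X] (A : Set X)

/-- If the inclusion `A ↪ X` is onto on `π₀`, every point of `X` is joined to a point of `A`.
[folklore] -/
theorem exists_joined_of_surjective_zerothHomotopyMap
    (h : Function.Surjective (zerothHomotopyMap (subsetIncl A))) (x : X) :
    ∃ a : X, a ∈ A ∧ Joined x a := by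
  obtain ⟨q, hq⟩ := h (ZerothHomotopy.mk x)
  induction q using Quotient.inductionOn with
  | h a =>
    have ha : ZerothHomotopy.mk (a : X) = ZerothHomotopy.mk x := by
      rw [← hq]; rfl
    exact ⟨a, a.2, (Quotient.exact ha : Joined (a : X) x).symm⟩

/-- **If the inclusion `A ↪ X` is a weak homotopy equivalence, all relative homotopy sets
`πₖ(X, A, a)`, `k ≥ 1`, are trivial** (exactness of the homotopy sequence of the pair, Hatcher
2002, Thm. 4.3: `∂c` dies under the injective `i_*`, so `c = j_* b`, and `b = i_* b'` by
surjectivity, so `c = j_* i_* b'` is trivial). [cite: HatcherAT2002, Thm. 4.3] -/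
theorem subsingleton_relHomotopyGroup_of_isWeakHomotopyEquiv
    (hf : IsWeakHomotopyEquiv (subsetIncl A)) (n : ℕ) (a : A) :
    Subsingleton (RelHomotopyGroup.Pi (n + 1) X A a) := by
  have key : ∀ c : RelHomotopyGroup.Pi (n + 1) X A a, c = default := fun c => by
    -- the boundary of `c` is trivial
    have hbd : RelHomotopyGroup.boundary c =
        (⟦GenLoop.const⟧ : HomotopyGroup {j : Fin (n + 1) // j ≠ (0 : Fin (n + 1))} A a) := by
      have h1 := RelHomotopyGroup.homotopyGroupIncl_boundary c
      obtain ⟨q, hq⟩ := Quotient.exists_rep (RelHomotopyGroup.boundary c)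
      rw [← hq] at h1 ⊢
      apply Quotient.sound
      apply hf.genLoopMap_injective_sub n 0 a q GenLoop.const
      rw [CubeLift.genLoopMap_const]
      exact Quotient.exact h1
    obtain ⟨b, rfl⟩ := RelHomotopyGroup.exists_ofAbsolute_eq c hbd
    obtain ⟨b', rfl⟩ := (hf.2 n a).2 b
    exact RelHomotopyGroup.ofAbsolute_homotopyGroupIncl b'
  exact ⟨fun c d => (key c).trans (key d).symm⟩

variable (R : Type v) [CommRing R]

/-- **`Hᵢ(X, A; R) = 0` for all `i` when the inclusion `A ↪ X` is a weak homotopy equivalence**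
(Spanier 1981, Ch. 7, Sec. 6, Thm. 25 for the pair; proof by the Eilenberg–Spanier deformation of
all singular simplices into `A`). [cite: Spanier1981, Ch. 7, Sec. 6, Thm. 25] -/
theorem isZero_relativeSingularHomology_of_isWeakHomotopyEquiv
    (hf : IsWeakHomotopyEquiv (subsetIncl A)) (i : ℕ) :
    IsZero (relativeSingularHomology R R X A i) := by
  have hj := exists_joined_of_surjective_zerothHomotopyMap A hf.1.2
  have hπ : ∀ k : ℕ, k + 1 ≤ i → ∀ a : A, Subsingleton (RelHomotopyGroup.Pi (k + 1) X A a) :=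
    fun k _ a => subsingleton_relHomotopyGroup_of_isWeakHomotopyEquiv A hf k a
  exact StagedDeformation.isZero_relativeSingularHomology (StagedDeformation.stageOfJoined hj hπ)
    (StagedDeformation.stageOfJoined_succ_face hj hπ) (R := R) i le_rfl

/-- **`Hᵢ(A; R) ≅ Hᵢ(X; R)` when the inclusion `A ↪ X` is a weak homotopy equivalence** (exact
sequence of the pair with `H_•(X, A; R) = 0`). [cite: Spanier1981, Ch. 7, Sec. 6, Thm. 25] -/
theorem isIso_singularHomology_map_subsetIncl_of_isWeakHomotopyEquiv
    (hf : IsWeakHomotopyEquiv (subsetIncl A)) (n : ℕ) :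
    IsIso (singularHomology.map R R (subsetIncl A) n) := by
  have hz := isZero_relativeSingularHomology_of_isWeakHomotopyEquiv A R hf
  -- mono: `Hₙ₊₁(X, A) →δ Hₙ(A) →i Hₙ(X)` exact with zero source
  haveI : Mono (singularHomology.map R R (subsetIncl A) n) :=
    (relativeSingularHomology.exact_δ_map R R A n).mono_g ((hz (n + 1)).eq_of_src _ _)
  -- epi: `Hₙ(A) →i Hₙ(X) →j Hₙ(X, A)` exact with zero target
  haveI : Epi (singularHomology.map R R (subsetIncl A) n) :=
    (relativeSingularHomology.exact_map_ofAbsolute R R A n).epi_f ((hz n).eq_of_tgt _ _)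
  exact isIso_of_mono_of_epi _

end Pair

/-! ### Spanier 7.6.25: weak homotopy equivalences induce isomorphisms on homology -/

section Map

variable {X Y Z : Type u} [TopologicalSpace X] [TopologicalSpace Y] [TopologicalSpace Z]

/-- **Two out of three**: if `g ∘ h` and `g` are weak homotopy equivalences, so is `h`.
[folklore] -/
theorem _root_.Literature.AlgebraicTopology.Homotopy.IsWeakHomotopyEquiv.of_comp_left
    {g : C(Y, Z)} {h : C(X, Y)} (hgh : IsWeakHomotopyEquiv (g.comp h)) (hg : IsWeakHomotopyEquiv g) :
    IsWeakHomotopyEquiv h := by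
  refine ⟨?_, fun n x => ?_⟩
  · have h0 := hgh.1
    rw [zerothHomotopyMap_comp] at h0
    exact (Function.Bijective.of_comp_iff' hg.1 _).1 h0
  · have h1 := hgh.2 n x
    rw [homotopyGroupMap_comp] at h1
    exact (Function.Bijective.of_comp_iff' (hg.2 n (h x)) _).1 h1

variable (R : Type v) [CommRing R]

/-- **A weak homotopy equivalence induces isomorphisms on singular homology** (Spanier 1981,
Ch. 7, Sec. 6, Thm. 25; Hatcher 2002, Prop. 4.21), any commutative coefficient ring, any spaces
of one universe: factor `f = retr ∘ inX` through the mapping cylinder; `inX` is a weak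
equivalence (two out of three, `retr` being a homotopy equivalence), so the inclusion of the
copy of `X` in `M_f` is one, whence an isomorphism on homology by
`isIso_singularHomology_map_subsetIncl_of_isWeakHomotopyEquiv`; and `retr_*` is an isomorphism.
[cite: Spanier1981, Ch. 7, Sec. 6, Thm. 25] -/
theorem isIso_singularHomology_map_of_isWeakHomotopyEquiv (f : C(X, Y))
    (hf : IsWeakHomotopyEquiv f) (n : ℕ) : IsIso (singularHomology.map R R f n) := by
  -- `retr` and `inY` are weak equivalences (homotopy equivalence `M_f ≃ₕ Y`)
  have hretr : IsWeakHomotopyEquiv (MappingCylinder.retr f) :=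
    isWeakHomotopyEquiv_homotopyEquiv (MappingCylinder.homotopyEquiv f)
  -- `inX` is a weak equivalence
  have hinX : IsWeakHomotopyEquiv (MappingCylinder.inX f) := by
    refine IsWeakHomotopyEquiv.of_comp_left ?_ hretr
    rw [MappingCylinder.retr_comp_inX]
    exact hf
  -- hence so is the inclusion of its image
  have hc : (subsetIncl (Set.range (MappingCylinder.inX f))) =
      (MappingCylinder.inX f).comp ((MappingCylinder.inXHomeomorph f).symm :
        C(Set.range (MappingCylinder.inX f), X)) := by
    have h := congrArg (fun g : C(X, MappingCylinder f) =>
        g.comp ((MappingCylinder.inXHomeomorph f).symm : C(Set.range (MappingCylinder.inX f), X)))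
      (MappingCylinder.subtypeVal_comp_inXHomeomorph f)
    simp only [ContinuousMap.comp_assoc, Homeomorph.toContinuousMap_comp_symm,
      ContinuousMap.comp_id] at h
    exact h
  have hincl : IsWeakHomotopyEquiv (subsetIncl (Set.range (MappingCylinder.inX f))) := by
    rw [hc]
    exact hinX.comp (IsWeakHomotopyEquiv.of_homeomorph (MappingCylinder.inXHomeomorph f).symm)
  haveI hiso := isIso_singularHomology_map_subsetIncl_of_isWeakHomotopyEquiv
    (Set.range (MappingCylinder.inX f)) R hincl n
  -- `(inX f)_*` is an isomorphism
  haveI : IsIso (singularHomology.map R R (MappingCylinder.inX f) n) := by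
    have h2 : MappingCylinder.inX f =
        (subsetIncl (Set.range (MappingCylinder.inX f))).comp
          ((MappingCylinder.inXHomeomorph f) : C(X, Set.range (MappingCylinder.inX f))) := by
      rw [hc, ContinuousMap.comp_assoc, Homeomorph.symm_comp_toContinuousMap, ContinuousMap.comp_id]
    rw [h2, singularHomology.map_comp]
    haveI : IsIso (singularHomology.map R R
        ((MappingCylinder.inXHomeomorph f) : C(X, Set.range (MappingCylinder.inX f))) n) :=
      inferInstanceAs (IsIso (singularHomology.mapIso R R (MappingCylinder.inXHomeomorph f) n).hom)
    infer_instance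
  -- `retr_*` is an isomorphism
  haveI : IsIso (singularHomology.map R R (MappingCylinder.retr f) n) :=
    inferInstanceAs (IsIso (singularHomology.isoOfHomotopyEquiv R R
      (MappingCylinder.homotopyEquiv f) n).hom)
  rw [← MappingCylinder.retr_comp_inX f, singularHomology.map_comp]
  infer_instance

end Map

end Literature.AlgebraicTopology.SingularHomology
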